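import Summits.ResolutionOfSingularities.ResolutionOfSingularities.Theorems.FrobeniusLadderFInjectiveMacaulayficationGenericFibreModel
import Summits.ResolutionOfSingularities.ResolutionOfSingularities.Theorems.FrobeniusLadderFInjectiveMacaulayficationNonFullLocusClosed
import Summits.ResolutionOfSingularities.ResolutionOfSingularities.Theorems.FrobeniusLadderFInjectiveMacaulayficationTameWildSplitDimLe
import Summits.ResolutionOfSingularities.ResolutionOfSingularities.Theorems.FrobeniusLadderFInjectiveMacaulayficationPointFixableTransport
import Literature.AlgebraicGeometry.Resolution.BlowupAlgebraPrimesPoints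
import Literature.AlgebraicGeometry.Resolution.BlowupsExistence
import Literature.AlgebraicGeometry.Resolution.KollarBlowupSequenceFunctors
import Literature.AlgebraicGeometry.Resolution.MarkedIdeals
import Literature.AlgebraicGeometry.Dimension.FibreLocalRingDimension
import Mathlib.AlgebraicGeometry.Noetherian
import HarnessLib

/-!
# Hole #3, WILD stratum, dim-2 rung in (A′)-currency: the LocFix-(A′) datum at a non-closed, non-normal bad point `η` with `dim 𝒪_η = 2`,
# from Lipman 1978 by the generic-fibre transfer (crux `FInjectiveMacaulayfication` stmt-ResolutionOfSingularities-15315, chain w45a;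
# res-L1-w45a-plan-1 R16.3 (4) «stub-3 NOW: `…WFixAtNonClosedDimTwo.lean`, `locFixAprime_atNonClosedWild_dimTwo_of_lipman (hL) (hDM) (hCMo)`»)

[OURS · L1 W4.5a · res-L1-w45a-stub-3] Support file (`--supports stmt-ResolutionOfSingularities-15315 --as helper`) for the crux
`FrobeniusLadder.FInjectiveMacaulayfication`; NOT a statement of any manuscript; AI-written, weaker than expert review. No definition and no
named fact is introduced: Lipman 1978 (`Lipman1978SequenceFinite`), Datta–Murayama 2024 (`DattaMurayama2024_fInjectiveLocusOpen`) and the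
openness of the Cohen–Macaulay locus (`NonFullLocusClosed.CMLocusOpen`) enter BY NAME as hypotheses.

WHY (A′) AND NOT THE PRIMARY DATUM. The PRIMARY point-fix statement at wild (non-normal) points — `PointFixAtNonClosedWild` of strat-1's
FC2Dim4Sig, equivalently the residual PFW2 of `PointFixWildDimTwo.pointFixAtNonClosedWild_dimTwo_of_pfw2` (p559911) — is REFUTED on paper
by strat-1's Theorem W (wild pinch `y² + u²ty + ut²`, memo H4LOC-KILL-WILDPINCH; plan-1 R16.2/R16.3: the Frobenius normal form on the
conductor-supported part of `H²_𝔪` kills a class on EVERY S₂ model, over every field of characteristic 2). What survives at wild points is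
the (A′)-currency of FC″ = `FCUnguardedRungs.FCUnguardedDimGe4` (l.220–228): a nonzero centre `(c′) ⊆ 𝔪_η` — NO radical condition, so
a centre THROUGH the non-normal curve is allowed — all of whose affine blow-up charts are FULL at the primes over `𝔪_η`. This file proves
that conjunct in stalk dimension 2.

THE THEOREM (`locFixAprime_atNonClosedWild_dimTwo_of_lipman`). For an admissible `(X₁, f₁)` over a field `k` of characteristic `p`
(separated, locally of finite type, quasi-compact, integral, `4 ≤ dim X₁`, all stalks Cohen–Macaulay) and a NON-closed point `η` with
`¬ FCl p 𝒪_η`, `dim 𝒪_η = 2`, all proper generizations `FCl`, and `𝒪_η` NOT integrally closed: there are `c′ : Fin n′ → 𝒪_η` with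
`(c′) ≠ 0`, `(c′) ⊆ 𝔪_η`, and `FullCl p` at every prime of every chart `𝒪_η[(c′)/c′_j]` over `𝔪_η` (the text of `FCUnguardedDimGe4`
l.220–228 VERBATIM).

PROOF. (1) The good locus of `X₁` is open (`NonFullLocusClosed.nonFullLocusClosed_of_named hDM hCMo`, all stalks CM), so the tree's
generic-fibre model `GenericFibreModel.genericFibreModel` gives an admissible `(X₀, f₀)` over a field `K₀` of characteristic `p` with
finite bad locus and a CLOSED bad point `b` with `e : 𝒪_{X₀,b} ≃+* 𝒪_{X₁,η}`. (2) `dim X₀ = dim 𝒪_{X₀,b} = 2` (`b` is closed: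
`height b = 0` in the specialisation order, and `coheight b + height b = dim X₀`, `coheight b = dim 𝒪_{X₀,b}` —
`coheight_add_height_eq_topologicalKrullDim`, `ringKrullDim_stalk_eq_coheight`). (3) Restrict to an affine open `U ∋ b`
(`admissible_restrict`: integral, CM stalks, finite bad locus, via the stalk isomorphisms `U.stalkIso`; `dim U ≤ dim X₀`). (4) `b` is
NOT tame in `U` (`TameAt` := integrally closed stalk, transported along `U.stalkIso b ≫ e`), so the tree's dim-2 W-rung
**`TameWildSplit.wfixClosedAffineDimLe2_of_lipman hL : WFixClosedAffineDimLe 2`** (p554313, from `WFixClosedAffineDim2OfLipman`) yields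
`SliceableCentre.CentreData p U b`: a global nonzero centre `J ∋ b` every blow-up along which is FULL over `supp J`. (5) THE ADAPTER
`locFixAprime_of_centreData` (global centre ⇒ affine-chart statement over `𝔪_b`): take generators `c` of the stalk `J_b` (Noetherian);
`(c) ≠ 0` (`stalkIdeal_ne_bot_of_ne_bot`, `U` integral), `(c) ⊆ 𝔪_b` (`mem_support_iff_stalkIdeal_le`); a blow-up `π : U' → U` along
`J` exists (`exists_isBlowup`), and every prime `𝔔` of `𝒪_b[(c)/c_j]` over `𝔪_b` is the local ring of a point `x' ∈ U'` over `b`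
(`IsBlowup.exists_point_of_blowupAlgebra_prime`, Stacks 0804/0805), where `π` is FULL since `b ∈ supp J`; `FullCl` transports along the
ring isomorphism (`fullCl_of_ringEquiv`). (6) Transport the (A′)-datum along `U.stalkIso b ≫ e` to `𝒪_{X₁,η}` (`locFixAprime_of_ringEquiv`,
the non-primary twin of `PointFixableTransport.pointFixable_of_ringEquiv`).
-/

-- single-problem summit: the doubled namespace component is forced
set_option linter.dupNamespace false

noncomputable section

open AlgebraicGeometry CategoryTheory Literature.AlgebraicGeometry.Resolution TopologicalSpace IsLocalRing Order

namespace Summit.ResolutionOfSingularities.ResolutionOfSingularities.Theorems.FInjectiveMacaulayfication.WFixAtNonClosedDimTwo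

open Summit.ResolutionOfSingularities.ResolutionOfSingularities.Theorems.FInjectiveMacaulayfication

/-! ## §1 `FullCl` and the (A′)-datum transport along ring isomorphisms -/

/-- `FullCl` (domain ∧ CM clause ∧ F-clause) transports along a ring isomorphism. [folklore] -/
theorem fullCl_of_ringEquiv (p : ℕ) {A B : Type} [CommRing A] [CommRing B] (e : A ≃+* B)
    (h : SliceableCentre.FullCl p A) : SliceableCentre.FullCl p B := by
  obtain ⟨hdom, hcl⟩ := h
  haveI := hdom
  exact ⟨MulEquiv.isDomain A e.symm.toMulEquiv, DegreeZeroDescent.inlineClause_of_ringEquiv p e hcl⟩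

/-- **The (A′)-datum transports along ring isomorphisms of local rings** — the non-primary twin of
`PointFixableTransport.pointFixable_of_ringEquiv` (`(c) ⊆ 𝔪` in place of `√(c) = 𝔪`). [folklore] -/
theorem locFixAprime_of_ringEquiv (p : ℕ) {O O' : Type} [CommRing O] [CommRing O'] [IsLocalRing O] [IsLocalRing O']
    (e : O ≃+* O')
    (h : ∃ (n : ℕ) (c : Fin n → O), Ideal.span (Set.range c) ≠ ⊥ ∧ Ideal.span (Set.range c) ≤ maximalIdeal O ∧
        ∀ (j : Fin n) (𝔔 : PrimeSpectrum (blowupAlgebra (Ideal.span (Set.range c)) (c j))),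
          𝔔.asIdeal.comap (algebraMap O (blowupAlgebra (Ideal.span (Set.range c)) (c j))) = maximalIdeal O →
          SliceableCentre.FullCl p (Localization.AtPrime 𝔔.asIdeal)) :
    ∃ (n : ℕ) (c : Fin n → O'), Ideal.span (Set.range c) ≠ ⊥ ∧ Ideal.span (Set.range c) ≤ maximalIdeal O' ∧
        ∀ (j : Fin n) (𝔔 : PrimeSpectrum (blowupAlgebra (Ideal.span (Set.range c)) (c j))),
          𝔔.asIdeal.comap (algebraMap O' (blowupAlgebra (Ideal.span (Set.range c)) (c j))) = maximalIdeal O' →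
          SliceableCentre.FullCl p (Localization.AtPrime 𝔔.asIdeal) := by
  obtain ⟨n, c, hne, hle, hcl⟩ := h
  have hI : Ideal.span (Set.range fun j : Fin n => e (c j)) = Ideal.map e (Ideal.span (Set.range c)) :=
    PointFixableTransport.span_range_comp e c
  refine ⟨n, fun j => e (c j), ?_, ?_, ?_⟩
  · rw [hI]
    exact fun h0 => hne ((Ideal.map_eq_bot_iff_of_injective e.injective).mp h0)
  · rw [hI, Ideal.map_le_iff_le_comap]
    intro x hx
    rw [Ideal.mem_comap]
    exact (PointFixableTransport.mem_maximalIdeal_iff e x).mpr (hle hx)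
  · intro j 𝔔' h𝔔'
    obtain ⟨E, hE⟩ := PointFixableTransport.exists_blowupAlgebra_congr' e (Ideal.span (Set.range c)) (c j) _ _ hI rfl
    -- the prime `𝔔 = E⁻¹ 𝔔'` of `O[(c)/c_j]` lies over `𝔪_O`
    let 𝔔 : PrimeSpectrum (blowupAlgebra (Ideal.span (Set.range c)) (c j)) :=
      ⟨𝔔'.asIdeal.comap E.toRingHom, Ideal.comap_isPrime _ _⟩
    have h𝔔 : 𝔔.asIdeal.comap (algebraMap O (blowupAlgebra (Ideal.span (Set.range c)) (c j))) = maximalIdeal O := by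
      ext x
      rw [Ideal.mem_comap, show x ∈ maximalIdeal O ↔ e x ∈ maximalIdeal O' from
        (PointFixableTransport.mem_maximalIdeal_iff e x).symm, ← h𝔔', Ideal.mem_comap]
      show E (algebraMap O _ x) ∈ 𝔔'.asIdeal ↔ algebraMap O' _ (e x) ∈ 𝔔'.asIdeal
      rw [hE x]
    have hF := hcl j 𝔔 h𝔔
    haveI := 𝔔.isPrime
    haveI := 𝔔'.isPrime
    obtain ⟨eL⟩ := BlowupFiModelOfCover.nonempty_ringEquiv_localization_of_ringEquiv E 𝔔.asIdeal 𝔔'.asIdeal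
      (fun x => Iff.rfl)
    exact fullCl_of_ringEquiv p eL hF

/-! ## §2 The adapter: a global `CentreData` at `b` gives the (A′)-datum in `𝒪_b` -/

/-- **ADAPTER `CentreData ⇒ (A′)`**: if a nonzero global centre `J ∋ b` has every blow-up FULL over `supp J`, then the generators `c`
of the stalk `J_b` form an (A′)-datum: `(c) ≠ 0`, `(c) ⊆ 𝔪_b`, and every prime of every affine chart `𝒪_b[(c)/c_j]` over `𝔪_b` is
FULL — because it is the local ring of a point of the blow-up over `b` (`IsBlowup.exists_point_of_blowupAlgebra_prime`).
[folklore; cite: StacksProject, Tag 0804] -/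
theorem locFixAprime_of_centreData (p : ℕ) {X : Scheme.{0}} [IsIntegral X] [IsLocallyNoetherian X] (b : X)
    (h : SliceableCentre.CentreData p X b) :
    ∃ (n : ℕ) (c : Fin n → X.presheaf.stalk b), Ideal.span (Set.range c) ≠ ⊥ ∧
      Ideal.span (Set.range c) ≤ maximalIdeal (X.presheaf.stalk b) ∧
      ∀ (j : Fin n) (𝔔 : PrimeSpectrum (blowupAlgebra (Ideal.span (Set.range c)) (c j))),
        𝔔.asIdeal.comap (algebraMap (X.presheaf.stalk b) (blowupAlgebra (Ideal.span (Set.range c)) (c j))) =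
          maximalIdeal (X.presheaf.stalk b) → SliceableCentre.FullCl p (Localization.AtPrime 𝔔.asIdeal) := by
  obtain ⟨J, hJ, hb, hfull⟩ := h
  have hfg : (stalkIdeal J b).FG := IsNoetherian.noetherian _
  obtain ⟨n, c, hc⟩ := Submodule.fg_iff_exists_fin_generating_family.mp hfg
  have hc' : Ideal.span (Set.range c) = stalkIdeal J b := hc
  obtain ⟨X', π, hπ⟩ := exists_isBlowup X J
  refine ⟨n, c, ?_, ?_, ?_⟩
  · rw [hc']
    exact stalkIdeal_ne_bot_of_ne_bot hJ b
  · rw [hc']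
    exact (mem_support_iff_stalkIdeal_le J b).mp hb
  · intro j 𝔔 h𝔔
    obtain ⟨x', hx', ⟨e⟩⟩ := hπ.exists_point_of_blowupAlgebra_prime b c hc' j 𝔔 h𝔔
    have hx : π.base x' ∈ (J.support : Set X) := by
      have h1 : π.base x' = b := hx'
      rw [h1]
      exact hb
    exact fullCl_of_ringEquiv p e (hfull X' π hπ x' hx)

/-! ## §3 Restriction of admissible data to an open subscheme; closed points and dimension -/

/-- Integrality, the CM clause at every stalk, and finiteness of the bad locus pass to an open subscheme `U ∋ b`
(stalks of `U` are stalks of `X`: `U.stalkIso`). [folklore] -/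
theorem admissible_restrict (p : ℕ) {X : Scheme.{0}} [IsIntegral X]
    (hCM : ∀ x : X, SliceableCentre.CMCl (X.presheaf.stalk x))
    (hfin : Set.Finite {x : X | ¬ SliceableCentre.FCl p (X.presheaf.stalk x)})
    (U : X.Opens) {b : X} (hb : b ∈ U) :
    IsIntegral (U : Scheme.{0}) ∧ (∀ x : U, SliceableCentre.CMCl ((U : Scheme.{0}).presheaf.stalk x)) ∧
      Set.Finite {x : U | ¬ SliceableCentre.FCl p ((U : Scheme.{0}).presheaf.stalk x)} := by
  haveI : Nonempty (U : Scheme.{0}) := ⟨⟨b, hb⟩⟩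
  refine ⟨isIntegral_of_isOpenImmersion U.ι,
    fun x => FiLocusOpenOfAffine.cmClause_of_ringEquiv (U.stalkIso x).commRingCatIsoToRingEquiv.symm (hCM x.1), ?_⟩
  refine (hfin.preimage fun x _ y _ hxy => Subtype.val_injective hxy).subset fun x hx => ?_
  show ¬ SliceableCentre.FCl p (X.presheaf.stalk x.1)
  exact fun h => hx (FiLocusOpenOfAffine.fClause_of_ringEquiv p (U.stalkIso x).commRingCatIsoToRingEquiv.symm h)

/-- A closed point of `X` lying in the open `U` is a closed point of `U`. [folklore] -/
theorem isClosed_singleton_restrict {X : Scheme.{0}} (U : X.Opens) {b : X} (hb : b ∈ U) (hcl : IsClosed ({b} : Set X)) :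
    IsClosed ({(⟨b, hb⟩ : U)} : Set U) := by
  have h : ({(⟨b, hb⟩ : U)} : Set U) = Subtype.val ⁻¹' {b} := Set.ext fun x => by
    constructor
    · intro hx
      have hx' : x = ⟨b, hb⟩ := hx
      subst hx'
      exact Set.mem_singleton b
    · intro hx
      exact Subtype.ext hx
  rw [h]
  exact hcl.preimage continuous_subtype_val

/-- **At a closed point the local dimension is the dimension** (`X` integral, locally of finite type over a field):
`dim X = dim 𝒪_{X,b}` — `height b = 0` and `coheight b + height b = dim X`. [folklore; cite: GortzWedhorn2020, Thm. 5.22] -/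
theorem topologicalKrullDim_eq_ringKrullDim_stalk_of_isClosed {K : Type} [Field K] {X : Scheme.{0}} [IsIntegral X]
    (f : X ⟶ Spec (.of K)) [LocallyOfFiniteType f] {b : X} (hb : IsClosed ({b} : Set X)) :
    topologicalKrullDim X = ringKrullDim (X.presheaf.stalk b) := by
  have h := Literature.AlgebraicGeometry.Dimension.coheight_add_height_eq_topologicalKrullDim f b
  rw [Scheme.height_of_isClosed hb, add_zero] at h
  rw [← h, ringKrullDim_stalk_eq_coheight]

/-! ## §4 The rung -/

/-- **Hole #3, wild stratum, dim-2 rung in (A′)-currency ⟸ Lipman 1978** (+ Datta–Murayama Thm. B and `CMLocusOpen` for the openness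
of the good locus): at a non-closed bad point `η` with `dim 𝒪_η = 2`, `𝒪_η` not integrally closed and all proper generizations good, the
LocFix-(A′) conjunct of `FCUnguardedRungs.FCUnguardedDimGe4` (l.220–228, verbatim). See the module docstring for the proof.
[folklore assembly; cite: Lipman1978, Thm. (desingularization of 2-dimensional excellent schemes); DattaMurayama2024, Thm. B] -/
theorem locFixAprime_atNonClosedWild_dimTwo_of_lipman
    (hL : Literature.AlgebraicGeometry.Resolution.Lipman1978SequenceFinite.{0})
    (hDM : Literature.AlgebraicGeometry.Resolution.DattaMurayama2024_fInjectiveLocusOpen.{0})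
    (hCMo : NonFullLocusClosed.CMLocusOpen) :
    ∀ (p : ℕ), p.Prime → ∀ (k : Type) [Field k] [CharP k p]
    (X₁ : Scheme.{0}) (f₁ : X₁ ⟶ Spec (.of k)),
      IsSeparated f₁ → LocallyOfFiniteType f₁ → QuasiCompact f₁ → IsIntegral X₁ → 4 ≤ topologicalKrullDim X₁ →
      (∀ x : X₁, SliceableCentre.CMCl (X₁.presheaf.stalk x)) →
      ∀ η : X₁, ¬ IsClosed ({η} : Set X₁) → ¬ SliceableCentre.FCl p (X₁.presheaf.stalk η) →
        ringKrullDim (X₁.presheaf.stalk η) = (2 : ℕ) →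
        (∀ y : X₁, y ⤳ η → y ≠ η → SliceableCentre.FCl p (X₁.presheaf.stalk y)) →
        ¬ IsIntegrallyClosed (X₁.presheaf.stalk η) →
        ∃ (n' : ℕ) (c' : Fin n' → X₁.presheaf.stalk η),
      Ideal.span (Set.range c') ≠ ⊥ ∧ Ideal.span (Set.range c') ≤ maximalIdeal (X₁.presheaf.stalk η) ∧
        (∀ (j : Fin n') (𝔔 : PrimeSpectrum (blowupAlgebra (Ideal.span (Set.range c')) (c' j))),
          𝔔.asIdeal.comap (algebraMap (X₁.presheaf.stalk η) (blowupAlgebra (Ideal.span (Set.range c')) (c' j))) =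
            maximalIdeal (X₁.presheaf.stalk η) →
          IsDomain (Localization.AtPrime 𝔔.asIdeal) ∧ ∀ d : ℕ, ringKrullDim (Localization.AtPrime 𝔔.asIdeal) = d →
            ∀ s : Fin d → Localization.AtPrime 𝔔.asIdeal, (Ideal.span (Set.range s)).radical.IsMaximal →
              RingTheory.Sequence.IsWeaklyRegular (Localization.AtPrime 𝔔.asIdeal) (List.ofFn s) ∧
              ∀ y : Localization.AtPrime 𝔔.asIdeal, (∃ e : ℕ, y ^ p ^ e ∈ Ideal.span ((fun z : Localization.AtPrime 𝔔.asIdeal => z ^ p ^ e) ''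
                (Ideal.span (Set.range s) : Set (Localization.AtPrime 𝔔.asIdeal)))) → y ∈ Ideal.span (Set.range s)) := by
  intro p hp k _ _ X₁ f₁ hsep hft hqc hint _ hCM η _ hbad hdim hgen hnn
  -- (1) the good locus is open (#2 by name + openness of the CM locus; all stalks are CM), and the generic-fibre model at `η`
  have hclosed := NonFullLocusClosed.nonFullLocusClosed_of_named hDM hCMo p hp k X₁ f₁ hft hqc hint
  have hopen : IsOpen {x : X₁ | SliceableCentre.FCl p (X₁.presheaf.stalk x)} := by
    have hset : {x : X₁ | SliceableCentre.FCl p (X₁.presheaf.stalk x)} =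
        {x : X₁ | ¬ NonFullLocusClosed.Clause p (X₁.presheaf.stalk x)}ᶜ := by
      ext x
      simp only [Set.mem_setOf_eq, Set.mem_compl_iff, not_not]
      rw [NonFullLocusClosed.clause_iff]
      exact ⟨fun h => ⟨hCM x, h⟩, fun h => h.2⟩
    rw [hset]
    exact hclosed.isOpen_compl
  obtain ⟨K₀, instF, instC, X₀, f₀, hsep₀, hft₀, hqc₀, hint₀, hCM₀, hfin₀, b, hbcl, hbbad, ⟨e⟩⟩ :=
    GenericFibreModel.genericFibreModel p hp k X₁ f₁ hft hint hCM hopen η hbad hgen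
  haveI := hsep₀
  haveI := hft₀
  haveI := hqc₀
  haveI := hint₀
  -- (2) `dim X₀ = dim 𝒪_{X₀,b} = dim 𝒪_{X₁,η} = 2`
  have hdim₀ : topologicalKrullDim X₀ = (2 : ℕ) := by
    rw [topologicalKrullDim_eq_ringKrullDim_stalk_of_isClosed f₀ hbcl, ringKrullDim_eq_of_ringEquiv e, hdim]
  -- (3) an affine open `U ∋ b` and the restricted data
  obtain ⟨U, hU, hbU, -⟩ := exists_isAffineOpen_mem_and_subset (X := X₀) (x := b) (U := ⊤) (Opens.mem_top b)
  haveI : IsAffine (U : Scheme.{0}) := hU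
  obtain ⟨hintU, hCMU, hfinU⟩ := admissible_restrict p hCM₀ hfin₀ U hbU
  haveI := hintU
  have hdimU : topologicalKrullDim (U : Scheme.{0}) ≤ (2 : ℕ) := by
    have h := U.ι.isOpenEmbedding.isInducing.topologicalKrullDim_le
    rw [hdim₀] at h
    exact h
  let b' : (U : Scheme.{0}) := ⟨b, hbU⟩
  have eU : (U : Scheme.{0}).presheaf.stalk b' ≃+* X₀.presheaf.stalk b := (U.stalkIso b').commRingCatIsoToRingEquiv
  have hbcl' : IsClosed ({b'} : Set (U : Scheme.{0})) := isClosed_singleton_restrict U hbU hbcl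
  have hbbad' : ¬ SliceableCentre.FCl p ((U : Scheme.{0}).presheaf.stalk b') :=
    fun h => hbbad (FiLocusOpenOfAffine.fClause_of_ringEquiv p eU h)
  -- (4) `b` is not tame in `U`, so the dim-2 W-rung applies
  have hnn' : ¬ TameWildSplit.TameAt (U : Scheme.{0}) b' := fun h => by
    haveI : IsIntegrallyClosed ((U : Scheme.{0}).presheaf.stalk b') := h
    haveI : IsIntegrallyClosed (X₀.presheaf.stalk b) := IsIntegrallyClosed.of_equiv eU
    exact hnn (IsIntegrallyClosed.of_equiv e)
  have hW : SliceableCentre.CentreData p (U : Scheme.{0}) b' :=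
    TameWildSplit.wfixClosedAffineDimLe2_of_lipman hL p hp K₀ (U : Scheme.{0}) (U.ι ≫ f₀) inferInstance inferInstance
      inferInstance hintU hdimU hU hCMU hfinU b' hbcl' hbbad' hnn'
  -- (5)+(6) adapter at `b'`, then transport along `𝒪_{U,b'} ≅ 𝒪_{X₀,b} ≅ 𝒪_{X₁,η}`
  haveI : IsLocallyNoetherian (U : Scheme.{0}) := LocallyOfFiniteType.isLocallyNoetherian (U.ι ≫ f₀)
  have hA := locFixAprime_of_centreData p (X := (U : Scheme.{0})) b' hW
  exact locFixAprime_of_ringEquiv p (eU.trans e) hA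

end Summit.ResolutionOfSingularities.ResolutionOfSingularities.Theorems.FInjectiveMacaulayfication.WFixAtNonClosedDimTwo

end
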